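import Literature.Probability.LatticeModels.GaussianPairingBound
import Literature.Probability.LatticeModels.TreeGraphWickPairing
import Literature.Probability.LatticeModels.ScalingLimit
import HarnessLib

/-!
# Greedy bound for the Gaussian pairing functional of a nonnegative kernel

Crux `stmt-CriticalPhenomena-8367` (`RotationUpgradeFromTwoPoint`), line
`null-laplacian-edge-gaussianity`, stubs `stub_pairingSum_le_prod` and `stub_corr_le_prod`.

For a nonnegative kernel `S₂` and a configuration `x` of `2k` points, if every weight `t i ≥ 1`
dominates the `i`-th row sum `∑_{j ≠ i} S₂ (x i) (x j)`, then the Gaussian pairing functional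
(`pairingSum`, the hafnian of the two-point matrix) satisfies `𝒢_k[S₂](x) ≤ ∏ i, t i`.
The proof is the greedy induction on `k` through the first-pair recursion `pairingSum_succ`:
removing the pair `(p, b(p,q))` (`b(p,q) = pairPerm p q 1`) leaves the sub-configuration
`x ∘ pairRest p q`, whose row sums are sub-sums of the original ones, whence by induction its
pairing functional is at most `∏_{j ∉ {p, b}} t j ≤ ∏_{j ≠ p} t j` (`map_univ_pairRest`); and
`∑_q S₂ (x p) (x (b(p,q))) = ∑_{j ≠ p} S₂ (x p) (x j) ≤ t p` because `q ↦ b(p,q)` enumerates the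
indices `≠ p` (`sum_pairPerm_one_eq_sum_erase`). Averaging over `p` gives the claim. The second
statement transfers the bound to a correlation family that is Gaussian-dominated on
non-coincident configurations, vanishes at odd orders and on coincident configurations, and has
a nonnegative two-point function.
-/

noncomputable section

open scoped BigOperators
open Literature.Probability.LatticeModels

namespace Summit.CriticalPhenomena.Ising3DConformalLimit.Cruxes.RotationUpgradeFromTwoPoint.NullLaplacianEdgeGaussianity

/-- Row sums of a sub-configuration listed injectively are sub-sums of the original row sums
(nonnegative kernel). [folklore] -/
theorem sum_erase_comp_le {α : Type*} (S₂ : α → α → ℝ) (hS : ∀ a b, 0 ≤ S₂ a b) {m n : ℕ}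
    (x : Fin n → α) {r : Fin m → Fin n} (hr : Function.Injective r) (i : Fin m) :
    ∑ j ∈ Finset.univ.erase i, S₂ (x (r i)) (x (r j)) ≤
      ∑ j ∈ Finset.univ.erase (r i), S₂ (x (r i)) (x j) := by
  rw [← Finset.sum_image (f := fun j => S₂ (x (r i)) (x j)) hr.injOn]
  refine Finset.sum_le_sum_of_subset_of_nonneg (fun j hj => ?_) (fun j _ _ => hS _ _)
  simp only [Finset.mem_image, Finset.mem_erase, Finset.mem_univ, and_true] at hj ⊢
  obtain ⟨a, ha, rfl⟩ := hj
  exact fun h => ha (hr h)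

/-- **Greedy bound for the Gaussian pairing functional** (any point type): for a nonnegative
kernel `S₂` and weights `t i ≥ 1` dominating the row sums `∑_{j ≠ i} S₂ (x i) (x j)`,
`𝒢_k[S₂](x) ≤ ∏ i, t i`. Induction on `k` via `pairingSum_succ`. [folklore] -/
theorem pairingSum_le_prod_of_rowSum_le {α : Type*} (S₂ : α → α → ℝ) (hS : ∀ a b, 0 ≤ S₂ a b)
    (k : ℕ) (x : Fin (2 * k) → α) (t : Fin (2 * k) → ℝ) (ht : ∀ i, 1 ≤ t i)
    (hrow : ∀ i, ∑ j ∈ Finset.univ.erase i, S₂ (x i) (x j) ≤ t i) :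
    pairingSum S₂ k x ≤ ∏ i, t i := by
  induction k with
  | zero =>
    calc pairingSum S₂ 0 x = 1 := by simp [pairingSum]
      _ ≤ ∏ i, t i := Finset.one_le_prod fun i _ => ht i
  | succ k ih =>
    have hpos : (0 : ℝ) < ((2 * (k + 1) : ℕ) : ℝ) := by positivity
    have ht0 : ∀ i, 0 ≤ t i := fun i => zero_le_one.trans (ht i)
    -- for each distinguished index `p`, the inner sum is at most `∏ i, t i`
    have hsum : ∑ p : Fin (2 * k + 2), ∑ q : Fin (2 * k + 1),
        S₂ (x p) (x (pairPerm p q 1)) * pairingSum S₂ k (x ∘ pairRest p q) ≤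
        ((2 * (k + 1) : ℕ) : ℝ) * ∏ i, t i := by
      calc ∑ p : Fin (2 * k + 2), ∑ q : Fin (2 * k + 1),
            S₂ (x p) (x (pairPerm p q 1)) * pairingSum S₂ k (x ∘ pairRest p q)
          ≤ ∑ p : Fin (2 * k + 2), ∑ q : Fin (2 * k + 1),
            S₂ (x p) (x (pairPerm p q 1)) * ∏ j ∈ Finset.univ.erase p, t j := by
            refine Finset.sum_le_sum fun p _ => Finset.sum_le_sum fun q _ => ?_
            refine mul_le_mul_of_nonneg_left ?_ (hS _ _)
            -- induction hypothesis on the sub-configuration, then drop the factor `t (b(p,q))`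
            calc pairingSum S₂ k (x ∘ pairRest p q)
                ≤ ∏ i, (t ∘ pairRest p q) i := by
                  refine ih (x ∘ pairRest p q) (t ∘ pairRest p q) (fun i => ht _) fun i => ?_
                  exact (sum_erase_comp_le S₂ hS x (pairRest_injective p q) i).trans (hrow _)
              _ = ∏ j ∈ (Finset.univ.erase p).erase (pairPerm p q 1), t j := by
                  rw [← map_univ_pairRest p q, Finset.prod_map]
                  rfl
              _ ≤ ∏ j ∈ Finset.univ.erase p, t j :=
                  Finset.prod_le_prod_of_subset_of_one_le (Finset.erase_subset _ _)
                    (fun j _ => ht0 j) (fun j _ _ => ht j)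
        _ = ∑ p : Fin (2 * k + 2), (∑ q : Fin (2 * k + 1), S₂ (x p) (x (pairPerm p q 1))) *
              ∏ j ∈ Finset.univ.erase p, t j :=
            Finset.sum_congr rfl fun p _ => (Finset.sum_mul _ _ _).symm
        _ ≤ ∑ p : Fin (2 * k + 2), t p * ∏ j ∈ Finset.univ.erase p, t j := by
            refine Finset.sum_le_sum fun p _ => ?_
            refine mul_le_mul_of_nonneg_right ?_ (Finset.prod_nonneg fun j _ => ht0 j)
            calc ∑ q : Fin (2 * k + 1), S₂ (x p) (x (pairPerm p q 1))
                = ∑ j ∈ Finset.univ.erase p, S₂ (x p) (x j) :=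
                  sum_pairPerm_one_eq_sum_erase p fun j => S₂ (x p) (x j)
              _ ≤ t p := hrow p
        _ = ∑ _p : Fin (2 * k + 2), ∏ i, t i :=
            Finset.sum_congr rfl fun p _ => Finset.mul_prod_erase Finset.univ t (Finset.mem_univ p)
        _ = ((2 * (k + 1) : ℕ) : ℝ) * ∏ i, t i := by
            rw [Finset.sum_const, Finset.card_univ, Fintype.card_fin, nsmul_eq_mul]
            push_cast
            ring
    rw [pairingSum_succ, inv_mul_le_iff₀ hpos]
    exact hsum

/-- W-comb (1): **greedy bound of the Gaussian pairing functional** in `ℝ³`. For a nonnegative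
kernel `S₂`, `2k` points `x` and weights `t i ≥ 1` with `∑_{j ≠ i} S₂ (x i) (x j) ≤ t i`,
`𝒢_k[S₂](x) ≤ ∏ i, t i` (the hafnian of a nonnegative matrix is at most the product over the
rows of `max(1, row sum)`). [folklore] -/
theorem stub_pairingSum_le_prod :
    ∀ (S₂ : EuclideanSpace ℝ (Fin 3) → EuclideanSpace ℝ (Fin 3) → ℝ), (∀ a b, 0 ≤ S₂ a b) →
      ∀ (k : ℕ) (x : Fin (2 * k) → EuclideanSpace ℝ (Fin 3)) (t : Fin (2 * k) → ℝ),
        (∀ i, 1 ≤ t i) → (∀ i, ∑ j ∈ Finset.univ.erase i, S₂ (x i) (x j) ≤ t i) →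
        pairingSum S₂ k x ≤ ∏ i, t i :=
  fun S₂ hS k x t ht hrow => pairingSum_le_prod_of_rowSum_le S₂ hS k x t ht hrow

/-- W-comb (2): **correlations are bounded by the product of the row-sum weights.** If a family
`S` of correlation functions on `ℝ³` is dominated by the Gaussian pairing functional of its
two-point function on non-coincident configurations, vanishes at odd orders and on coincident
configurations, and has `S 2 ≥ 0`, then for weights `t i ≥ 1` dominating the row sums
`∑_{j ≠ i} S₂(x i, x j)` one has `S N x ≤ ∏ i, t i`. [folklore] -/
theorem stub_corr_le_prod :
    ∀ (S : CorrFamily 3),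
      (∀ (n : ℕ) (x : Fin (2 * n) → EuclideanSpace ℝ (Fin 3)), x ∈ NonCoincident 3 (2 * n) →
        S (2 * n) x ≤ pairingSum (fun a b => S 2 ![a, b]) n x) →
      (∀ (n : ℕ) (x : Fin n → EuclideanSpace ℝ (Fin 3)), Odd n → S n x = 0) →
      (∀ (n : ℕ) (z : Fin n → EuclideanSpace ℝ (Fin 3)), z ∉ NonCoincident 3 n → S n z = 0) →
      (∀ a b : EuclideanSpace ℝ (Fin 3), 0 ≤ S 2 ![a, b]) →
      ∀ (N : ℕ) (x : Fin N → EuclideanSpace ℝ (Fin 3)) (t : Fin N → ℝ),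
        (∀ i, 1 ≤ t i) → (∀ i, ∑ j ∈ Finset.univ.erase i, S 2 ![x i, x j] ≤ t i) →
        S N x ≤ ∏ i, t i := by
  intro S hdom hodd hcoin hpos N x t ht hrow
  have hprod : (0 : ℝ) ≤ ∏ i, t i := zero_le_one.trans (Finset.one_le_prod fun i _ => ht i)
  rcases Nat.even_or_odd N with hN | hN
  · obtain ⟨k, rfl⟩ := even_iff_two_dvd.mp hN
    by_cases hx : x ∈ NonCoincident 3 (2 * k)
    · exact (hdom k x hx).trans
        (pairingSum_le_prod_of_rowSum_le (fun a b => S 2 ![a, b]) hpos k x t ht hrow)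
    · rw [hcoin _ x hx]
      exact hprod
  · rw [hodd N x hN]
    exact hprod

end Summit.CriticalPhenomena.Ising3DConformalLimit.Cruxes.RotationUpgradeFromTwoPoint.NullLaplacianEdgeGaussianity

end
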